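import Mathlib
import Summits.NavierStokesRegularity.NavierStokesRegularity.Theorems.SubcriticalEnvelopeDefs
import Summits.NavierStokesRegularity.NavierStokesRegularity.Theorems.SubOnsagerCeilingOrthantTailCeilingDyadicRatioTwoTools
import Summits.NavierStokesRegularity.NavierStokesRegularity.Theorems.SubcriticalEnvelopeForwardSourceTailEnvelopeRedressing
import Literature.Analysis.FluidPDE.TaoCascadeODEProofs
import HarnessLib

/-!
# `SubcriticalEnvelope.ForwardSourceTailEnvelopeKP` (stmt-NavierStokesRegularity-27130) — KP
PERMUTATION NETWORKS as interleaved chains: closed forms, nonlinearity, strands, intertwining and the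
honesty transfer (file 1 of 3 of the LEAD-SE rung «uniform KP permutation networks», `--supports`)

LEAD-SE helper (tenure 13:25:30Z «natural next helper in your own lane», KEY-NS #140 (2)(ii)).  The
KP permutation network `kpPermTable σ c` (`Theorems/SubcriticalEnvelopeDefs.lean`; one Katz–Pavlović
feed `x_{a,k}² → x_{σ a,k+1}` with coefficient `c a` out of every component, `σ` a permutation of the
four components) is the general «one feed in, one feed out» KP-proper orthant architecture in the class
of the cruxes 27057 / 27130 / 26999: it contains the one-mode chain (`σ = 1`), the 2-cycle of the
previous rung (`σ = swap 0 1`), the 3- and 4-cycles and all products of disjoint cycles and parallel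
chains.  Its lattice is FOUR INTERLEAVED nearest-neighbour chains («strands»): the strand of `a₀`
lives on the component `permPhase σ a₀ k = (σ^k) a₀` at shell `k`, and the drain partner of a mode is
the next mode of the SAME strand.

* `kpPermTable_feed/_up1/_up2/_inshell` — closed forms on the four shifts;
* `quadTerm_kpPerm` — the network nonlinearity of the mode `(i, n)`:
  `c(σ⁻¹ i)·(1+ε₀)^{5(n-1)/2}·X_{σ⁻¹ i,n-1}² − c(i)·(1+ε₀)^{5n/2}·X_{i,n}·X_{σ i,n+1}`;
* `permPhase_zero/_succ/_pred`, `orbitConst_permPhase` — phase bookkeeping; `permStrand_zero/_of_ne`;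
* `quadTerm_kpPerm_phase` — GENERAL REDUCTION (any `c`): each strand obeys a chain equation whose
  bond coefficients are read along the orbit (`c (permPhase σ a₀ (n-1))` in, `c (permPhase σ a₀ n)`
  out) — a PERIODIC Katz–Pavlović chain, period = the cycle length;
* `quadTerm_permStrand` — orbit-constant coefficients: the strand's `(c a₀)·dyadicTable` nonlinearity
  IS the network nonlinearity of the occupied mode (INTERTWINING, for every family `X`);
* `permStrand_honest` — strands of honest network solutions (one-shell datum, noLow, (4.5) bound,
  continuity, exact ν-viscous motion, non-negativity on shells `≥ 1`) are honest `(c a₀)·dyadicTable`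
  solutions from the datum `X₀(a₀)·e₀`;
* `kpPerm_coeff_nonneg_of_orthant` — the orthant clause of the cruxes forces `c ≥ 0`;
* `kpPermTable_sourceComplete` — the syntactic forward sources are `{a : c a ≠ 0}`.

Siblings: `…KPPermClass.lean` (table class E₂(R), orthant, diagonal feeds; the chain and the 2-cycle
as instances) and `…KPPerm.lean` (the ratio-agnostic transfer and the rung on `ε₀ ∈ [31/50, 1]`).

HONEST FRAMING: algebra and bookkeeping about Tao-type MODEL lattice ODEs (rung TL-M2Break); no crux
is proved; nothing here concerns the Navier–Stokes equations; NS regularity is NOT advanced.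
-/

noncomputable section

-- the sub-problem namespace `NavierStokesRegularity.NavierStokesRegularity` is the tree's layout (D-0017)
set_option linter.dupNamespace false

namespace Summit.NavierStokesRegularity.NavierStokesRegularity.Theorems

open Set
open Literature.Analysis.FluidPDE.TaoCascade

/-! ## §1 Closed forms of the permutation network on the four shifts -/

/-- Values on the feed shift `(0,0,1)`. [this file] -/
theorem kpPermTable_feed (σ : Equiv.Perm (Fin 4)) (c : Fin 4 → ℝ) (i₁ i₂ i₃ : Fin 4) :
    kpPermTable σ c i₁ i₂ i₃ ((0 : ℤ), (0 : ℤ), (1 : ℤ)) =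
      if i₁ = i₂ ∧ i₃ = σ i₁ then c i₁ else 0 := by
  simp [kpPermTable]

/-- Values on the shift `(1,0,0)`. [this file] -/
theorem kpPermTable_up1 (σ : Equiv.Perm (Fin 4)) (c : Fin 4 → ℝ) (i₁ i₂ i₃ : Fin 4) :
    kpPermTable σ c i₁ i₂ i₃ ((1 : ℤ), (0 : ℤ), (0 : ℤ)) =
      if i₁ = σ i₂ ∧ i₃ = i₂ then -(c i₂ / 2) else 0 := by
  simp [kpPermTable]

/-- Values on the shift `(0,1,0)`. [this file] -/
theorem kpPermTable_up2 (σ : Equiv.Perm (Fin 4)) (c : Fin 4 → ℝ) (i₁ i₂ i₃ : Fin 4) :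
    kpPermTable σ c i₁ i₂ i₃ ((0 : ℤ), (1 : ℤ), (0 : ℤ)) =
      if i₂ = σ i₁ ∧ i₃ = i₁ then -(c i₁ / 2) else 0 := by
  simp [kpPermTable]

/-- Values on the in-shell shift `(0,0,0)`: none. [this file] -/
theorem kpPermTable_inshell (σ : Equiv.Perm (Fin 4)) (c : Fin 4 → ℝ) (i₁ i₂ i₃ : Fin 4) :
    kpPermTable σ c i₁ i₂ i₃ ((0 : ℤ), (0 : ℤ), (0 : ℤ)) = 0 := by
  simp [kpPermTable]

/-! ## §2 The network nonlinearity -/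

/-- A double sum over a condition pinning both indices. [folklore] -/
theorem sum_sum_ite_pin (a b : Fin 4) (v : ℝ) (w g : Fin 4 → Fin 4 → ℝ) :
    (∑ i₁ : Fin 4, ∑ i₂ : Fin 4, (if i₁ = a ∧ i₂ = b then v else 0) * w i₁ i₂ * g i₁ i₂) =
      v * w a b * g a b := by
  rw [Finset.sum_eq_single a]
  · rw [Finset.sum_eq_single b]
    · simp
    · intro i₂ _ h
      rw [if_neg (fun hh => h hh.2), zero_mul, zero_mul]
    · intro h; exact absurd (Finset.mem_univ b) h
  · intro i₁ _ h
    exact Finset.sum_eq_zero fun i₂ _ => by rw [if_neg (fun hh => h hh.1), zero_mul, zero_mul]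
  · intro h; exact absurd (Finset.mem_univ a) h

/-- **The permutation-network nonlinearity of the mode `(i, n)`**: fed by the square of its orbit
predecessor one shell below (coefficient `c (σ⁻¹ i)`), drained by its own feed into `(σ i, n+1)`
(coefficient `c i`). [this file] -/
theorem quadTerm_kpPerm (ε₀ : ℝ) (σ : Equiv.Perm (Fin 4)) (c : Fin 4 → ℝ)
    (X : Fin 4 → ℤ → ℝ → ℝ) (i : Fin 4) (n : ℤ) (t : ℝ) :
    quadTerm ε₀ (kpPermTable σ c) X i n t =
      c (σ.symm i) * ((1 + ε₀) ^ ((5 : ℝ) * (n - 1) / 2) * X (σ.symm i) (n - 1) t ^ 2) -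
        c i * ((1 + ε₀) ^ ((5 : ℝ) * n / 2) * (X i n t * X (σ i) (n + 1) t)) := by
  -- expand the shift-set sum, then pin the component indices
  have hfeed : ∀ i₁ i₂ : Fin 4, (kpPermTable σ c i₁ i₂ i ((0 : ℤ), (0 : ℤ), (1 : ℤ))) =
      if i₁ = σ.symm i ∧ i₂ = σ.symm i then c (σ.symm i) else 0 := by
    intro i₁ i₂
    rw [kpPermTable_feed]
    by_cases h : i₁ = σ.symm i ∧ i₂ = σ.symm i
    · obtain ⟨h1, h2⟩ := h
      subst h1; subst h2
      simp
    · rw [if_neg h, if_neg]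
      rintro ⟨h1, h2⟩
      apply h
      have : i₁ = σ.symm i := by rw [h2]; simp
      exact ⟨this, h1 ▸ this⟩
  have hup1 : ∀ i₁ i₂ : Fin 4, (kpPermTable σ c i₁ i₂ i ((1 : ℤ), (0 : ℤ), (0 : ℤ))) =
      if i₁ = σ i ∧ i₂ = i then -(c i / 2) else 0 := by
    intro i₁ i₂
    rw [kpPermTable_up1]
    by_cases h : i₁ = σ i ∧ i₂ = i
    · obtain ⟨h1, h2⟩ := h
      subst h2; subst h1
      simp
    · rw [if_neg h, if_neg]
      rintro ⟨h1, h2⟩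
      exact h ⟨h2 ▸ h1, h2.symm⟩
  have hup2 : ∀ i₁ i₂ : Fin 4, (kpPermTable σ c i₁ i₂ i ((0 : ℤ), (1 : ℤ), (0 : ℤ))) =
      if i₁ = i ∧ i₂ = σ i then -(c i / 2) else 0 := by
    intro i₁ i₂
    rw [kpPermTable_up2]
    by_cases h : i₁ = i ∧ i₂ = σ i
    · obtain ⟨h1, h2⟩ := h
      subst h1; subst h2
      simp
    · rw [if_neg h, if_neg]
      rintro ⟨h1, h2⟩
      exact h ⟨h2.symm, h2 ▸ h1⟩
  unfold quadTerm
  simp only [sum_shiftSet, kpPermTable_inshell, zero_mul, zero_add, Finset.sum_add_distrib, hfeed,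
    hup1, hup2]
  rw [sum_sum_ite_pin, sum_sum_ite_pin, sum_sum_ite_pin]
  push_cast
  ring_nf

/-! ## §3 Phase bookkeeping -/

/-- At the datum shell the strand of `a₀` sits on `a₀`. [this file] -/
theorem permPhase_zero (σ : Equiv.Perm (Fin 4)) (a₀ : Fin 4) : permPhase σ a₀ 0 = a₀ := by
  simp [permPhase]

/-- One shell up the strand moves along `σ`. [this file] -/
theorem permPhase_succ (σ : Equiv.Perm (Fin 4)) (a₀ : Fin 4) (k : ℤ) :
    permPhase σ a₀ (k + 1) = σ (permPhase σ a₀ k) := by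
  simp only [permPhase]
  rw [add_comm, zpow_one_add, Equiv.Perm.mul_apply]

/-- One shell down the strand moves along `σ⁻¹`. [this file] -/
theorem permPhase_pred (σ : Equiv.Perm (Fin 4)) (a₀ : Fin 4) (k : ℤ) :
    permPhase σ a₀ (k - 1) = σ.symm (permPhase σ a₀ k) := by
  have h := permPhase_succ σ a₀ (k - 1)
  rw [sub_add_cancel] at h
  rw [h]; simp

/-- If `c` is constant on `σ`-orbits, it is constant along every strand. [this file] -/
theorem orbitConst_permPhase {σ : Equiv.Perm (Fin 4)} {c : Fin 4 → ℝ} (hcyc : ∀ a, c (σ a) = c a)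
    (a₀ : Fin 4) : ∀ k : ℤ, c (permPhase σ a₀ k) = c a₀ := by
  have hsymm : ∀ a, c (σ.symm a) = c a := fun a => by
    conv_rhs => rw [← Equiv.apply_symm_apply σ a]
    exact (hcyc _).symm
  intro k
  induction k using Int.induction_on with
  | zero => rw [permPhase_zero]
  | succ n ih => rw [permPhase_succ, hcyc, ih]
  | pred n ih => rw [permPhase_pred, hsymm, ih]

/-- Component `0` of a strand reads the lattice at the phase. [this file] -/
theorem permStrand_zero (σ : Equiv.Perm (Fin 4)) (a₀ : Fin 4) (X : Fin 4 → ℤ → ℝ → ℝ) (k : ℤ)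
    (t : ℝ) : permStrand σ a₀ X 0 k t = X (permPhase σ a₀ k) k t := by
  simp [permStrand]

/-- Components `≠ 0` of a strand vanish. [this file] -/
theorem permStrand_of_ne (σ : Equiv.Perm (Fin 4)) (a₀ : Fin 4) (X : Fin 4 → ℤ → ℝ → ℝ) {i : Fin 4}
    (hi : i ≠ 0) (k : ℤ) (t : ℝ) : permStrand σ a₀ X i k t = 0 := by
  simp [permStrand, hi]

/-! ## §4 The intertwining identity -/

/-- **GENERAL REDUCTION (any coefficients `c`): each strand obeys a nearest-neighbour CHAIN equation
whose bond coefficients are read along the orbit.**  Along ANY family `X`, at shell `n` the network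
nonlinearity of the mode the strand of `a₀` occupies is
`c(permPhase σ a₀ (n-1))·(1+ε₀)^{5(n-1)/2}·Y_{n-1}² − c(permPhase σ a₀ n)·(1+ε₀)^{5n/2}·Y_n·Y_{n+1}`
in the strand amplitudes `Y_m = (permStrand σ a₀ X) 0 m`: a PERIODIC Katz–Pavlović chain (period =
the length of the cycle of `a₀`; no barrier for non-constant periodic chains is in the tree).  Pure
algebra. [this file] -/
theorem quadTerm_kpPerm_phase (ε₀ : ℝ) (σ : Equiv.Perm (Fin 4)) (c : Fin 4 → ℝ) (a₀ : Fin 4)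
    (X : Fin 4 → ℤ → ℝ → ℝ) (n : ℤ) (t : ℝ) :
    quadTerm ε₀ (kpPermTable σ c) X (permPhase σ a₀ n) n t =
      c (permPhase σ a₀ (n - 1)) *
          ((1 + ε₀) ^ ((5 : ℝ) * (n - 1) / 2) * permStrand σ a₀ X 0 (n - 1) t ^ 2) -
        c (permPhase σ a₀ n) *
          ((1 + ε₀) ^ ((5 : ℝ) * n / 2) * (permStrand σ a₀ X 0 n t * permStrand σ a₀ X 0 (n + 1) t)) := by
  rw [permStrand_zero, permStrand_zero, permStrand_zero, quadTerm_kpPerm, permPhase_pred,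
    permPhase_succ]

/-- **INTERTWINING (orbit-constant coefficients).** If `c` is constant on `σ`-orbits then, along ANY
family `X`, the `(c a₀)·dyadicTable` nonlinearity of the strand of `a₀` at shell `n` equals the
network nonlinearity of the lattice mode the strand occupies there:
`quadTerm ε₀ ((c a₀)·dyadicTable) (permStrand σ a₀ X) 0 n t = quadTerm ε₀ (kpPermTable σ c) X (permPhase σ a₀ n) n t`.
Pure algebra. [this file] -/
theorem quadTerm_permStrand (ε₀ : ℝ) {σ : Equiv.Perm (Fin 4)} {c : Fin 4 → ℝ}
    (hcyc : ∀ a, c (σ a) = c a) (a₀ : Fin 4) (X : Fin 4 → ℤ → ℝ → ℝ) (n : ℤ) (t : ℝ) :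
    quadTerm ε₀ (fun i₁ i₂ i₃ μ => c a₀ * dyadicTable i₁ i₂ i₃ μ) (permStrand σ a₀ X) 0 n t =
      quadTerm ε₀ (kpPermTable σ c) X (permPhase σ a₀ n) n t := by
  rw [dyadicRatioTwo_quadTerm_const_mul (β := dyadicTable) (c := c a₀) (fun _ _ _ _ => rfl),
    quadTerm_dyadicTable_zero, quadTerm_kpPerm_phase, orbitConst_permPhase hcyc,
    orbitConst_permPhase hcyc]
  ring

/-! ## §5 Strands of honest network solutions are honest chain solutions -/

/-- **Honesty transfer to a strand.**  If `X` satisfies the solution clauses of the cruxes for the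
permutation network `kpPermTable σ c` (`c` constant on `σ`-orbits) on `[0,s]` from the one-shell datum
`X₀` and is non-negative on shells `≥ 1`, then `permStrand σ a₀ X` satisfies them for
`(c a₀)·dyadicTable` from the datum `X₀(a₀)·e₀`, and is non-negative on shells `≥ 1`.  MODEL lattice
bookkeeping. [this file] -/
theorem permStrand_honest {ε₀ ν s : ℝ} {σ : Equiv.Perm (Fin 4)} {c : Fin 4 → ℝ}
    (hcyc : ∀ a, c (σ a) = c a) (a₀ : Fin 4) {X₀ : Fin 4 → ℝ} {X : Fin 4 → ℤ → ℝ → ℝ}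
    (hinit : ∀ (i : Fin 4) (k : ℤ), X i k 0 = if k = 0 then X₀ i else 0)
    (hlow : ∀ (i : Fin 4) (k : ℤ), k < 0 → ∀ t : ℝ, X i k t = 0)
    (hbd : ∃ M : ℝ, ∀ (t : ℝ) (i : Fin 4) (k : ℤ), (1 + (1 + ε₀) ^ ((10 : ℝ) * k)) * |X i k t| ≤ M)
    (hcont : ∀ (i : Fin 4) (k : ℤ), Continuous (X i k))
    (hder : ∀ (i : Fin 4) (k : ℤ), ∀ t ∈ Icc (0 : ℝ) s, HasDerivWithinAt (X i k)
      (quadTerm ε₀ (kpPermTable σ c) X i k t - ν * (1 + ε₀) ^ ((2 : ℝ) * k) * X i k t)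
      (Icc (0 : ℝ) s) t)
    (hnn : ∀ t ∈ Icc (0 : ℝ) s, ∀ (i : Fin 4) (k : ℤ), 1 ≤ k → 0 ≤ X i k t) :
    (∀ (i : Fin 4) (k : ℤ), permStrand σ a₀ X i k 0 =
        if k = 0 then (fun i : Fin 4 => if i = 0 then X₀ a₀ else 0) i else 0) ∧
    (∀ (i : Fin 4) (k : ℤ), k < 0 → ∀ t : ℝ, permStrand σ a₀ X i k t = 0) ∧
    (∃ M : ℝ, ∀ (t : ℝ) (i : Fin 4) (k : ℤ),
      (1 + (1 + ε₀) ^ ((10 : ℝ) * k)) * |permStrand σ a₀ X i k t| ≤ M) ∧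
    (∀ (i : Fin 4) (k : ℤ), Continuous (permStrand σ a₀ X i k)) ∧
    (∀ (i : Fin 4) (k : ℤ), ∀ t ∈ Icc (0 : ℝ) s, HasDerivWithinAt (permStrand σ a₀ X i k)
      (quadTerm ε₀ (fun i₁ i₂ i₃ μ => c a₀ * dyadicTable i₁ i₂ i₃ μ) (permStrand σ a₀ X) i k t -
        ν * (1 + ε₀) ^ ((2 : ℝ) * k) * permStrand σ a₀ X i k t) (Icc (0 : ℝ) s) t) ∧
    (∀ t ∈ Icc (0 : ℝ) s, ∀ (i : Fin 4) (k : ℤ), 1 ≤ k → 0 ≤ permStrand σ a₀ X i k t) := by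
  obtain ⟨M, hM⟩ := hbd
  have hM0 : 0 ≤ M := by
    have h := hM 0 0 0
    have h1 : (0 : ℝ) ≤ (1 + (1 + ε₀) ^ ((10 : ℝ) * ((0 : ℤ) : ℝ))) * |X 0 0 0| := by
      have : (1 + ε₀) ^ ((10 : ℝ) * ((0 : ℤ) : ℝ)) = 1 := by simp
      rw [this]; positivity
    exact h1.trans h
  refine ⟨fun i k => ?_, fun i k hk t => ?_, ⟨M, fun t i k => ?_⟩, fun i k => ?_, fun i k t ht => ?_,
    fun t ht i k hk => ?_⟩
  · -- datum
    by_cases hi : i = 0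
    · subst hi
      rw [permStrand_zero, hinit]
      by_cases hk : k = 0
      · subst hk; simp [permPhase_zero]
      · simp [hk]
    · rw [permStrand_of_ne σ a₀ X hi]
      by_cases hk : k = 0 <;> simp [hk, hi]
  · -- no low shells
    by_cases hi : i = 0
    · subst hi; rw [permStrand_zero]; exact hlow _ k hk t
    · exact permStrand_of_ne σ a₀ X hi k t
  · -- (4.5) bound
    by_cases hi : i = 0
    · subst hi; rw [permStrand_zero]; exact hM t _ k
    · rw [permStrand_of_ne σ a₀ X hi, abs_zero, mul_zero]; exact hM0
  · -- continuity
    by_cases hi : i = 0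
    · subst hi
      have : permStrand σ a₀ X 0 k = X (permPhase σ a₀ k) k :=
        funext fun t => permStrand_zero σ a₀ X k t
      rw [this]; exact hcont _ k
    · have : permStrand σ a₀ X i k = fun _ => 0 := funext fun t => permStrand_of_ne σ a₀ X hi k t
      rw [this]; exact continuous_const
  · -- exact motion
    by_cases hi : i = 0
    · subst hi
      have hfun : permStrand σ a₀ X 0 k = X (permPhase σ a₀ k) k :=
        funext fun t => permStrand_zero σ a₀ X k t
      rw [hfun, quadTerm_permStrand ε₀ hcyc]
      exact hder _ k t ht
    · have hfun : permStrand σ a₀ X i k = fun _ => 0 :=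
        funext fun t => permStrand_of_ne σ a₀ X hi k t
      have hq : quadTerm ε₀ (fun i₁ i₂ i₃ μ => c a₀ * dyadicTable i₁ i₂ i₃ μ) (permStrand σ a₀ X) i k t
          = 0 := dyadicRatioTwo_quadTerm_of_ne (fun _ _ _ _ => rfl) _ hi k t
      rw [hfun, hq]
      simpa using hasDerivWithinAt_const t (Icc (0 : ℝ) s) (0 : ℝ)
  · -- non-negativity on shells ≥ 1
    by_cases hi : i = 0
    · subst hi; rw [permStrand_zero]; exact hnn t ht _ k hk
    · rw [permStrand_of_ne σ a₀ X hi]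

/-! ## §6 Signs and sources -/

/-- **The orthant clause of the cruxes forces non-negative feed coefficients.**  Testing the clause
on the family with a unit amplitude on the mode `(a, 1)` and nothing else (shell `2` of the
component `σ a` is fed by `c a · (1+δ)^{5/2}`). MODEL lattice bookkeeping. [this file] -/
theorem kpPerm_coeff_nonneg_of_orthant {σ : Equiv.Perm (Fin 4)} {c : Fin 4 → ℝ}
    (hO : ∀ (Y : Fin 4 → ℤ → ℝ → ℝ) (τ : ℝ), (∀ (j : Fin 4) (k : ℤ), 1 ≤ k → 0 ≤ Y j k τ) →
      ∀ δ : ℝ, 0 < δ → ∀ (i : Fin 4) (n : ℤ), 1 ≤ n → Y i n τ = 0 →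
      0 ≤ quadTerm δ (kpPermTable σ c) Y i n τ) (a : Fin 4) : 0 ≤ c a := by
  set Y : Fin 4 → ℤ → ℝ → ℝ := fun j k _ => if j = a ∧ k = 1 then 1 else 0 with hY
  have hYnn : ∀ (j : Fin 4) (k : ℤ), 1 ≤ k → 0 ≤ Y j k 0 := by
    intro j k _; simp only [hY]; split_ifs <;> norm_num
  have hY2 : Y (σ a) 2 0 = 0 := by simp [hY]
  have h := hO Y 0 hYnn 1 one_pos (σ a) 2 (by norm_num) hY2
  rw [quadTerm_kpPerm] at h
  have h1 : Y (σ.symm (σ a)) (2 - 1) 0 = 1 := by simp [hY]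
  have h3 : Y (σ (σ a)) (2 + 1) 0 = 0 := by simp [hY]
  rw [h1, h3, mul_zero, mul_zero, mul_zero, sub_zero, Equiv.symm_apply_apply] at h
  have hw : (0 : ℝ) < (1 + 1) ^ ((5 : ℝ) * ((2 : ℤ) - 1) / 2) * (1 : ℝ) ^ 2 := by positivity
  exact nonneg_of_mul_nonneg_left (by simpa using h) hw

/-- **The syntactic forward sources of the permutation network are the components with a non-zero
feed coefficient** (`S⁺(α) = {a : c a ≠ 0}`): a component with `c a = 0` carries no `(0,0,1)`
coefficient. [this file] -/
theorem kpPermTable_sourceComplete (σ : Equiv.Perm (Fin 4)) (c : Fin 4 → ℝ) :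
    ∀ i, i ∉ (Finset.univ.filter fun a : Fin 4 => c a ≠ 0) →
      ∀ j l : Fin 4, kpPermTable σ c i j l (0, 0, 1) = 0 := by
  intro i hi j l
  have hc : c i = 0 := by simpa using hi
  rw [kpPermTable_feed]
  split_ifs <;> simp [hc]

end Summit.NavierStokesRegularity.NavierStokesRegularity.Theorems

end
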